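import Literature.Analysis.FluidPDE.BBGKYMarginalsProofs
import HarnessLib

/-!
# Continuity estimates for the iterated collision operators of the hierarchies (BGSR Lemma 4.2)
(Bodineau–Gallagher–Saint-Raymond, Invent. Math. 203 (2016) = arXiv:1305.3397v2, §4.2,
Lemma 4.2 and its proof, pp. 11–12; after Gallagher–Saint-Raymond–Texier 2013, Part II Ch. 5
(erratum); trunk T-KINETIC, topic MathematicalPhysics/KineticTheory; a layer (N3 of the
bottom-up plan recorded in `TaggedSphereLinearBoltzmann`) of the proof of the named fact
`Hilbert6.bgsr_theorem22`, needed for the pruning argument of BGSR Prop. 4.3.)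

BGSR §4.2 introduces the weighted spaces `X_{ε,k,λ}`, `X_{0,k,λ}` of `k`-particle functions with
norm `sup_{Z_k} |f_k(Z_k) exp(λ H_k(Z_k))|`, `H_k(Z_k) = ½ ∑_{i ≤ k} |v_i|²`
(`Kinetic.configEnergy`), and Lemma 4.2 states: *there is a constant `C_d` depending only on
`d` such that for all `s, n ∈ ℕ*` and all `t ≥ 0`, for all `f_{s+n} ∈ X_{ε,s+n,λ}`,
`‖|Q|_{s,s+n}(t) f_{s+n}‖_{ε,s,λ/2} ≤ e^{s-1} (C_d t / λ^{(d+1)/2})^n ‖f_{s+n}‖_{ε,s+n,λ}`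
((4.9)), and similarly `‖|Q⁰|_{s,s+n}(t) g_{s+n}‖_{0,s,λ/2} ≤ e^{s-1} (C_d t / λ^{(d+1)/2})^n
‖g_{s+n}‖_{0,s+n,λ}` ((4.10))*, where `Q_{s,s+n}(t) = ∫_0^t ∫_0^{t_1} ⋯ ∫_0^{t_{n-1}} S_s(t - t_1)
C_{s,s+1} S_{s+1}(t_1 - t_2) C_{s+1,s+2} ⋯ S_{s+n}(t_n) dt_n ⋯ dt_1` are the iterated Duhamel
operators of the BBGKY hierarchy ((3.5)), `Q⁰` those of the Boltzmann hierarchy ((3.8)), and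
`|Q|`, `|Q⁰|` "the operator[s] obtained by summing the absolute values of all elementary
contributions". The printed proof (p. 11–12): the transports preserve the weighted norms; the
elementary collision operators satisfy ((4.11))
`|C_{k,k+1} g_{k+1}(Z_k)| ≤ C_d λ^{-d/2} (k λ^{-1/2} + ∑_{i ≤ k} |v_i|) exp(-λ H_k(Z_k))
‖g_{k+1}‖_{k+1,λ}`; "piling together those inequalities (distributing the exponential weight
evenly on each occurence of a collision term)", with
`∑_i |v_i| exp(-(λ/4n) ∑_j |v_j|²) ≤ (2nk/(eλ))^{1/2} ≤ (2/(eλ))^{1/2} (s + n)`, "each collision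
operator gives therefore a loss of `C λ^{-(d+1)/2} (s+n)` together with a loss on the
exponential weight, while the integration with respect to time provides a factor `tⁿ/n!`. By
Stirling's formula … `(s+n)ⁿ/n! ≤ exp(s+n)`."

This file PROVES Lemma 4.2 along exactly these lines, on the accepted hierarchy objects of
`Literature.Analysis.FluidPDE.BBGKYMarginals` (`Kinetic.duhamelTerm`, `Kinetic.hsCollisionTerm`,
`Kinetic.boltzmannHOp`, `Kinetic.bbgkyOp`, `Kinetic.boltzmannDuhamelTerm`,
`Kinetic.bbgkyDuhamelTerm`), in the following form. The weighted norms are not introduced as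
objects: a bound `‖g‖_{k,λ} ≤ K` is the hypothesis `∀ Z, |g Z| ≤ K exp(-λ H_k(Z))`, and the
conclusion bounds `|Q_{s,s+n}(t) g|` pointwise by `e^{s-1} (C_d t/λ^{(d+1)/2})^n K
exp(-(λ/2) H_s)`. The printed `|Q|` (absolute values of the gain and loss contributions summed)
is not a tree object; the proof bounds precisely that majorant (the pointwise bound
`abs_hsCollisionIntegrand_le_weighted` is on `|gain| + |loss|`), so the estimates hold verbatim
for `|Q|` and a fortiori for `Q` (`|Q g| ≤ |Q| |g|`). All time integrals are Mathlib interval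
integrals (junk value `0` on non-integrable integrands); since only upper bounds by explicit
integrable majorants are used (`norm_integral_le_of_norm_le`), NO measurability hypothesis on
the densities, the flows or the geometry is needed.

## What is proved

* `integral_norm_add_mul_exp_le` — the Gaussian moment bound behind `λ^{-(d+1)/2}`:
  `∫ (|v| + a) e^{-λ|v|²/2} dv ≤ λ^{-d/2} (λ^{-1/2} + a) J_d`, `J_d = ∫ (1 + |u|) e^{-|u|²/2} du`
  (scaling `v = λ^{-1/2} u`, `Measure.integral_comp_smul`).
* `abs_hsCollisionTerm_le_weighted` — (4.11) for one elementary collision term `C^i_{k,k+1}`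
  at any diameter `ε` and in any geometry: `|C^i g (Z_k)| ≤ C_d λ^{-d/2} (λ^{-1/2} + |v_i|)
  e^{-λ H_k(Z_k)} K` if `|g| ≤ K e^{-λ H_{k+1}}` (energy conservation in the collision
  configurations, `configEnergy_gainConfig`/`configEnergy_lossConfig`), with the explicit
  `C_d = J_d |S^{d-1}|`; `abs_boltzmannHOp_le_weighted` ((4.11) for `C⁰_{k,k+1}`) and
  `abs_bbgkyOp_le_weighted` (for `C_{k,k+1}`, extra factor `N ε^{d-1}`) by summing over `i`.
* `sum_norm_mul_exp_neg_mul_configEnergy_le` — the absorption of the velocity moment by a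
  fraction `δ` of the weight: `(∑_i |v_i|) e^{-δ H_k} ≤ (k/δ)^{1/2}` (Cauchy–Schwarz and
  `x e^{-x} ≤ 1`; the printed `(2nk/(eλ))^{1/2}` with `δ = λ/2n`, up to the harmless `e^{-1/2}`).
* `abs_duhamelChain_le_weighted` — the "piling" induction, for an ABSTRACT chain: any family
  `R n s t` satisfying the Duhamel recursion `R (n+1) s t = ∫_0^t T_s(t-τ) C_s (R n (s+1) τ) dτ`
  with transports `T_s` that are compositions with energy-preserving maps and collision
  operators `C_s` satisfying (4.11) with constant `A`: if `|R 0 (s+n) τ| ≤ K e^{-(λ₀ + nδ) H}` on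
  `[0, T]` then `|R n s t| ≤ K Λⁿ tⁿ/n! e^{-λ₀ H_s}` on `[0, T]`, where
  `Λ = A λ_m^{-d/2} (k_max λ_m^{-1/2} + (k_max/δ)^{1/2})` for any lower bound `λ_m ≤ λ₀` of the
  weights and any bound `k_max` on the particle numbers met. (Stated for an abstract family so
  that both the Duhamel terms `Q_{s,s+n}(t) F₀` — `abs_duhamelTerm_le_weighted` — and the
  remainders of finitely iterated Duhamel formulas, whose innermost slot is time dependent, are
  covered; the free parameters `λ_m, δ, k_max` serve the multi-block chains of BGSR Prop. 4.3,
  where the weight loss is distributed over the operators of several consecutive blocks.)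
* `chainConst_le`, `pow_chainConst_mul_le` — the arithmetic of the printed constants: with
  `λ_m = λ₀ = λ/2`, `δ = λ/2n`, `k_max = s + n - 1`, one has `Λ ≤ A 2^{(d+3)/2} (s+n)/λ^{(d+1)/2}`
  and `Λⁿ tⁿ/n! ≤ e^{s-1} (C t/λ^{(d+1)/2})ⁿ` for `n ≥ 1`, `C = e² 2^{(d+3)/2} A`
  (`Real.pow_div_factorial_le_exp`: `(s+n)ⁿ/n! ≤ e^{s+n}`).
* `bgsr_lemma42_boltzmann` — **(4.10)**: there is `C`, depending only on `d`, such that for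
  every position space and geometry, every `λ > 0`, `s`, `n ≥ 1`, `t ≥ 0` and every initial
  family with `|F₀^{(s+n)}| ≤ B e^{-λ H_{s+n}}`, `B ≥ 0`:
  `|Q⁰_{s,s+n}(t) F₀ (Z_s)| ≤ e^{s-1} (C t / λ^{(d+1)/2})ⁿ B e^{-(λ/2) H_s(Z_s)}`.
* `bgsr_lemma42_bbgky` — **(4.9)** in the tree's normalisation of `C_{s,s+1}` (prefactor
  `(N - s) ε^{d-1}`, GST (4.3.5), instead of BGSR's `(N - s) ε^{d-1} α^{-1}` of (3.4)): the same
  bound with `C t` replaced by `C N ε^{d-1} t`, for hard-sphere transports along any flows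
  conserving the kinetic energy (the hypothesis `hΦE` of
  `Kinetic.IsMildBBGKYSolutionOn.eq_sum_bbgkyDuhamelTerm`).

`λ^{(d+1)/2}` is written `Real.sqrt λ ^ (d + 1)` and `λ^{-d/2}` as `(Real.sqrt λ ^ d)⁻¹`.

## References

* T. Bodineau, I. Gallagher, L. Saint-Raymond, *The Brownian motion as the limit of a
  deterministic system of hard-spheres*, Invent. Math. 203 (2016) 493–553 = arXiv:1305.3397v2,
  §4.2, Lemma 4.2, (4.9)–(4.11), pp. 11–12.
* I. Gallagher, L. Saint-Raymond, B. Texier, *From Newton to Boltzmann: hard spheres and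
  short-range potentials*, EMS (2013) and erratum, Part II Ch. 5 (continuity estimates).
-/

open MeasureTheory Metric Real Set Filter Topology
open scoped InnerProductSpace ENNReal Nat

universe u

namespace Literature.MathematicalPhysics.KineticTheory

noncomputable section

section Kinetic

variable {d : Type*} [Fintype d] {X : Type*} {s : ℕ}

/-! ## Gaussian velocity moments: the scaling `λ^{-(d+1)/2}` -/

section Gaussian

omit [Fintype d] in
/-- `(|v| + a) e^{-λ|v|²/2}` is integrable on `ℝ^d` for `λ > 0`. [folklore] -/
theorem integrable_norm_add_mul_exp [Fintype d] {b : ℝ} (hb : 0 < b) (a : ℝ) (ha : 0 ≤ a) :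
    Integrable fun v : EuclideanSpace ℝ d => (‖v‖ + a) * exp (-(b / 2) * ‖v‖ ^ 2) := by
  have h := (Literature.Analysis.FluidPDE.integrable_one_add_norm_mul_exp (E := EuclideanSpace ℝ d) hb).const_mul (1 + a)
  refine h.mono' ?_ (Eventually.of_forall fun v => ?_)
  · exact (by fun_prop : Continuous fun v : EuclideanSpace ℝ d =>
      (‖v‖ + a) * exp (-(b / 2) * ‖v‖ ^ 2)).aestronglyMeasurable
  · rw [Real.norm_of_nonneg (by positivity)]
    have h1 : ‖v‖ + a ≤ (1 + a) * (1 + ‖v‖) := by nlinarith [norm_nonneg v, mul_nonneg ha (norm_nonneg v)]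
    calc (‖v‖ + a) * exp (-(b / 2) * ‖v‖ ^ 2)
        ≤ ((1 + a) * (1 + ‖v‖)) * exp (-(b / 2) * ‖v‖ ^ 2) := by gcongr
      _ = (1 + a) * ((1 + ‖v‖) * exp (-(b / 2) * ‖v‖ ^ 2)) := by ring

omit [Fintype d] in
/-- **The Gaussian moment bound behind `λ^{-(d+1)/2}`**: for `λ > 0` and `a ≥ 0`,
`∫_{ℝ^d} (|v| + a) e^{-λ|v|²/2} dv ≤ λ^{-d/2} (λ^{-1/2} + a) ∫_{ℝ^d} (1 + |u|) e^{-|u|²/2} du`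
(substitution `v = λ^{-1/2} u`, `Measure.integral_comp_smul`, and `λ^{-1/2}|u| + a ≤
(λ^{-1/2} + a)(1 + |u|)`). [folklore] -/
theorem integral_norm_add_mul_exp_le [Fintype d] {b : ℝ} (hb : 0 < b) {a : ℝ} (ha : 0 ≤ a) :
    ∫ v : EuclideanSpace ℝ d, (‖v‖ + a) * exp (-(b / 2) * ‖v‖ ^ 2) ≤
      (sqrt b ^ Fintype.card d)⁻¹ * ((sqrt b)⁻¹ + a) *
        ∫ u : EuclideanSpace ℝ d, (1 + ‖u‖) * exp (-(1 / 2) * ‖u‖ ^ 2) := by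
  set Φ : EuclideanSpace ℝ d → ℝ := fun u => ((sqrt b)⁻¹ * ‖u‖ + a) * exp (-(1 / 2) * ‖u‖ ^ 2)
    with hΦ
  have hsq : 0 < sqrt b := sqrt_pos.2 hb
  have hcomp : (fun v : EuclideanSpace ℝ d => (‖v‖ + a) * exp (-(b / 2) * ‖v‖ ^ 2)) =
      fun v => Φ (sqrt b • v) := by
    funext v
    simp only [hΦ, norm_smul, Real.norm_eq_abs, abs_of_pos hsq]
    have h1 : (sqrt b)⁻¹ * (sqrt b * ‖v‖) = ‖v‖ := by field_simp
    have h2 : (sqrt b * ‖v‖) ^ 2 = b * ‖v‖ ^ 2 := by rw [mul_pow, sq_sqrt hb.le]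
    rw [h1, h2]
    congr 1
    congr 1
    ring
  rw [hcomp, Measure.integral_comp_smul_of_nonneg (μ := volume) Φ (sqrt b) (hR := hsq.le),
    finrank_euclideanSpace, smul_eq_mul, mul_assoc]
  refine mul_le_mul_of_nonneg_left ?_ (inv_nonneg.2 (pow_nonneg hsq.le _))
  rw [← integral_const_mul]
  refine integral_mono_of_nonneg (Eventually.of_forall fun u => ?_)
    ((Literature.Analysis.FluidPDE.integrable_one_add_norm_mul_exp (E := EuclideanSpace ℝ d) one_pos).const_mul _)
    (Eventually.of_forall fun u => ?_)
  · simp only [hΦ, Pi.zero_apply]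
    positivity
  · simp only [hΦ]
    have h1 : (sqrt b)⁻¹ * ‖u‖ + a ≤ ((sqrt b)⁻¹ + a) * (1 + ‖u‖) := by
      nlinarith [inv_nonneg.2 hsq.le, norm_nonneg u, mul_nonneg ha (norm_nonneg u)]
    calc ((sqrt b)⁻¹ * ‖u‖ + a) * exp (-(1 / 2) * ‖u‖ ^ 2)
        ≤ (((sqrt b)⁻¹ + a) * (1 + ‖u‖)) * exp (-(1 / 2) * ‖u‖ ^ 2) := by gcongr
      _ = ((sqrt b)⁻¹ + a) * ((1 + ‖u‖) * exp (-(1 / 2) * ‖u‖ ^ 2)) := by ring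

end Gaussian

/-! ## (4.11): the elementary collision operators in the weighted norms -/

section SingleStep

/-- Sharp pointwise bound on the integrand of the hard-sphere collision term: if
`|g| ≤ K e^{-λ H}` then, by conservation of the kinetic energy in the collision configurations
and `|ω·(v - v_i)| ≤ |v| + |v_i|`,
`|(ω·(v - v_i))_+ g(gain)| + |(ω·(v - v_i))_- g(loss)| ≤ K e^{-λ H(Z_s)} (|v| + |v_i|)
e^{-λ|v|²/2}` (a fortiori for the difference). [folklore] -/
theorem abs_hsCollisionIntegrand_le_weighted (G : Literature.Analysis.FluidPDE.Geometry d X) (ε : ℝ) (i : Fin s) {K b : ℝ}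
    {g : Literature.Analysis.FluidPDE.Config (s + 1) d X → ℝ} (hg : ∀ Z, |g Z| ≤ K * exp (-b * Literature.Analysis.FluidPDE.configEnergy Z))
    (Zs : Literature.Analysis.FluidPDE.Config s d X) (ω : sphere (0 : EuclideanSpace ℝ d) 1) (v : EuclideanSpace ℝ d) :
    |max ⟪(ω : EuclideanSpace ℝ d), v - (Zs i).2⟫_ℝ 0 * g (Literature.Analysis.FluidPDE.gainConfig G ε Zs i ω v)| +
        |max (-⟪(ω : EuclideanSpace ℝ d), v - (Zs i).2⟫_ℝ) 0 * g (Literature.Analysis.FluidPDE.lossConfig G ε Zs i ω v)| ≤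
      (K * exp (-b * Literature.Analysis.FluidPDE.configEnergy Zs)) * ((‖v‖ + ‖(Zs i).2‖) * exp (-(b / 2) * ‖v‖ ^ 2)) := by
  set A := ⟪(ω : EuclideanSpace ℝ d), v - (Zs i).2⟫_ℝ with hA
  set B := K * exp (-b * (Literature.Analysis.FluidPDE.configEnergy Zs + 2⁻¹ * ‖v‖ ^ 2)) with hB
  have hgain : |g (Literature.Analysis.FluidPDE.gainConfig G ε Zs i ω v)| ≤ B := by
    have h := hg (Literature.Analysis.FluidPDE.gainConfig G ε Zs i ω v)
    rwa [Literature.Analysis.FluidPDE.configEnergy_gainConfig] at h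
  have hloss : |g (Literature.Analysis.FluidPDE.lossConfig G ε Zs i ω v)| ≤ B := by
    have h := hg (Literature.Analysis.FluidPDE.lossConfig G ε Zs i ω v)
    rwa [Literature.Analysis.FluidPDE.configEnergy_lossConfig] at h
  have hB0 : 0 ≤ B := (abs_nonneg _).trans hgain
  have hApos : 0 ≤ max A 0 := le_max_right _ _
  have hAneg : 0 ≤ max (-A) 0 := le_max_right _ _
  have hsum : max A 0 + max (-A) 0 = |A| := by
    rcases le_total 0 A with h | h
    · rw [max_eq_left h, max_eq_right (by linarith), abs_of_nonneg h, add_zero]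
    · rw [max_eq_right h, max_eq_left (by linarith), abs_of_nonpos h, zero_add]
  have hAle : |A| ≤ ‖v‖ + ‖(Zs i).2‖ := by
    calc |A| ≤ ‖(ω : EuclideanSpace ℝ d)‖ * ‖v - (Zs i).2‖ := abs_real_inner_le_norm _ _
      _ = ‖v - (Zs i).2‖ := by rw [norm_eq_of_mem_sphere ω, one_mul]
      _ ≤ ‖v‖ + ‖(Zs i).2‖ := norm_sub_le _ _
  have hBexp : B = K * exp (-b * Literature.Analysis.FluidPDE.configEnergy Zs) * exp (-(b / 2) * ‖v‖ ^ 2) := by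
    rw [hB, mul_assoc, ← Real.exp_add]
    congr 2
    ring
  calc |max A 0 * g (Literature.Analysis.FluidPDE.gainConfig G ε Zs i ω v)| + |max (-A) 0 * g (Literature.Analysis.FluidPDE.lossConfig G ε Zs i ω v)|
      = max A 0 * |g (Literature.Analysis.FluidPDE.gainConfig G ε Zs i ω v)| + max (-A) 0 * |g (Literature.Analysis.FluidPDE.lossConfig G ε Zs i ω v)| := by
        rw [abs_mul, abs_mul, abs_of_nonneg hApos, abs_of_nonneg hAneg]
    _ ≤ max A 0 * B + max (-A) 0 * B :=
        add_le_add (mul_le_mul_of_nonneg_left hgain hApos) (mul_le_mul_of_nonneg_left hloss hAneg)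
    _ = |A| * B := by rw [← add_mul, hsum]
    _ ≤ (‖v‖ + ‖(Zs i).2‖) * B := mul_le_mul_of_nonneg_right hAle hB0
    _ = (K * exp (-b * Literature.Analysis.FluidPDE.configEnergy Zs)) * ((‖v‖ + ‖(Zs i).2‖) * exp (-(b / 2) * ‖v‖ ^ 2)) := by
        rw [hBexp]; ring

/-- **BGSR (4.11) for one elementary collision term**, at any diameter `ε` and in any geometry:
if `|g| ≤ K e^{-λ H_{k+1}}` (`λ > 0`) then
`|C^i_{k,k+1} g (Z_k)| ≤ C_d λ^{-d/2} (λ^{-1/2} + |v_i|) K e^{-λ H_k(Z_k)}` with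
`C_d = (∫ (1 + |u|) e^{-|u|²/2} du) · |S^{d-1}|` (the gain and loss contributions are bounded
separately, so this is the bound for the `i`-th term of `|C_{k,k+1}|`).
[cite: BodineauGallagherSaintRaymondInvent2016, §4.2 (4.11), p. 12] -/
theorem abs_hsCollisionTerm_le_weighted (G : Literature.Analysis.FluidPDE.Geometry d X) (ε : ℝ) (i : Fin s) {K b : ℝ}
    (hb : 0 < b) {g : Literature.Analysis.FluidPDE.Config (s + 1) d X → ℝ} (hg : ∀ Z, |g Z| ≤ K * exp (-b * Literature.Analysis.FluidPDE.configEnergy Z))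
    (Zs : Literature.Analysis.FluidPDE.Config s d X) :
    |Literature.Analysis.FluidPDE.hsCollisionTerm G ε s i g Zs| ≤
      ((∫ u : EuclideanSpace ℝ d, (1 + ‖u‖) * exp (-(1 / 2) * ‖u‖ ^ 2)) *
          (KineticTheory.sphereMeasure : Measure (sphere (0 : EuclideanSpace ℝ d) 1)).real univ) *
        (sqrt b ^ Fintype.card d)⁻¹ * ((sqrt b)⁻¹ + ‖(Zs i).2‖) *
        (K * exp (-b * Literature.Analysis.FluidPDE.configEnergy Zs)) := by
  haveI := Literature.Analysis.FluidPDE.isFiniteMeasure_sphereMeasure (E := EuclideanSpace ℝ d)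
  set J : ℝ := ∫ u : EuclideanSpace ℝ d, (1 + ‖u‖) * exp (-(1 / 2) * ‖u‖ ^ 2) with hJ
  set S : ℝ := (KineticTheory.sphereMeasure : Measure (sphere (0 : EuclideanSpace ℝ d) 1)).real univ
    with hS
  set M : ℝ := K * exp (-b * Literature.Analysis.FluidPDE.configEnergy Zs) with hM
  have hK : 0 ≤ K := by
    have h := (abs_nonneg _).trans (hg (Literature.Analysis.FluidPDE.lossConfig G ε Zs i 0 0))
    exact (mul_nonneg_iff_of_pos_right (Real.exp_pos _)).1 h
  have hM0 : 0 ≤ M := by positivity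
  set ψ : EuclideanSpace ℝ d → ℝ := fun v => (‖v‖ + ‖(Zs i).2‖) * exp (-(b / 2) * ‖v‖ ^ 2)
    with hψ
  have hψi : Integrable ψ := integrable_norm_add_mul_exp hb _ (norm_nonneg _)
  have hψle : ∫ v, ψ v ≤ (sqrt b ^ Fintype.card d)⁻¹ * ((sqrt b)⁻¹ + ‖(Zs i).2‖) * J :=
    integral_norm_add_mul_exp_le hb (norm_nonneg _)
  -- the inner (velocity) integrals
  have hinner : ∀ ω : sphere (0 : EuclideanSpace ℝ d) 1,
      ‖∫ v : EuclideanSpace ℝ d,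
          (max ⟪(ω : EuclideanSpace ℝ d), v - (Zs i).2⟫_ℝ 0 * g (Literature.Analysis.FluidPDE.gainConfig G ε Zs i ω v) -
            max (-⟪(ω : EuclideanSpace ℝ d), v - (Zs i).2⟫_ℝ) 0 * g (Literature.Analysis.FluidPDE.lossConfig G ε Zs i ω v))‖ ≤
        M * ∫ v, ψ v := fun ω =>
    (norm_integral_le_of_norm_le (hψi.const_mul M) (Eventually.of_forall fun v => by
      rw [Real.norm_eq_abs]
      exact (abs_sub _ _).trans (abs_hsCollisionIntegrand_le_weighted G ε i hg Zs ω v))).trans_eq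
      (integral_const_mul _ _)
  -- the outer (impact direction) integral
  have hout : |Literature.Analysis.FluidPDE.hsCollisionTerm G ε s i g Zs| ≤ (M * ∫ v, ψ v) * S := by
    rw [← Real.norm_eq_abs]
    unfold Literature.Analysis.FluidPDE.hsCollisionTerm
    calc _ ≤ ∫ _ω, (M * ∫ v, ψ v) ∂KineticTheory.sphereMeasure :=
          norm_integral_le_of_norm_le (integrable_const _) (Eventually.of_forall hinner)
      _ = (M * ∫ v, ψ v) * S := by rw [integral_const, smul_eq_mul, mul_comm]
  have hS0 : 0 ≤ S := measureReal_nonneg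
  calc |Literature.Analysis.FluidPDE.hsCollisionTerm G ε s i g Zs| ≤ (M * ∫ v, ψ v) * S := hout
    _ ≤ (M * ((sqrt b ^ Fintype.card d)⁻¹ * ((sqrt b)⁻¹ + ‖(Zs i).2‖) * J)) * S := by gcongr
    _ = (J * S) * (sqrt b ^ Fintype.card d)⁻¹ * ((sqrt b)⁻¹ + ‖(Zs i).2‖) * M := by ring

/-- **BGSR (4.11) for the Boltzmann hierarchy collision operator** `C⁰_{k,k+1} = ∑_{i<k}
C^{0,i}_{k,k+1}`: if `|g| ≤ K e^{-λ H_{k+1}}` then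
`|C⁰_{k,k+1} g (Z_k)| ≤ C_d λ^{-d/2} (k λ^{-1/2} + ∑_{i<k} |v_i|) K e^{-λ H_k(Z_k)}`.
[cite: BodineauGallagherSaintRaymondInvent2016, §4.2 (4.11), p. 12] -/
theorem abs_boltzmannHOp_le_weighted (G : Literature.Analysis.FluidPDE.Geometry d X) (s : ℕ) {K b : ℝ} (hb : 0 < b)
    {g : Literature.Analysis.FluidPDE.Config (s + 1) d X → ℝ} (hg : ∀ Z, |g Z| ≤ K * exp (-b * Literature.Analysis.FluidPDE.configEnergy Z))
    (Zs : Literature.Analysis.FluidPDE.Config s d X) :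
    |Literature.Analysis.FluidPDE.boltzmannHOp G s g Zs| ≤
      ((∫ u : EuclideanSpace ℝ d, (1 + ‖u‖) * exp (-(1 / 2) * ‖u‖ ^ 2)) *
          (KineticTheory.sphereMeasure : Measure (sphere (0 : EuclideanSpace ℝ d) 1)).real univ) *
        (sqrt b ^ Fintype.card d)⁻¹ * (s * (sqrt b)⁻¹ + ∑ i, ‖(Zs i).2‖) *
        (K * exp (-b * Literature.Analysis.FluidPDE.configEnergy Zs)) := by
  unfold Literature.Analysis.FluidPDE.boltzmannHOp Literature.Analysis.FluidPDE.boltzmannHierarchyOp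
  calc |∑ i : Fin s, Literature.Analysis.FluidPDE.hsCollisionTerm G 0 s i g Zs|
      ≤ ∑ i : Fin s, |Literature.Analysis.FluidPDE.hsCollisionTerm G 0 s i g Zs| := Finset.abs_sum_le_sum_abs _ _
    _ ≤ ∑ i : Fin s,
        ((∫ u : EuclideanSpace ℝ d, (1 + ‖u‖) * exp (-(1 / 2) * ‖u‖ ^ 2)) *
            (KineticTheory.sphereMeasure : Measure (sphere (0 : EuclideanSpace ℝ d) 1)).real univ) *
          (sqrt b ^ Fintype.card d)⁻¹ * ((sqrt b)⁻¹ + ‖(Zs i).2‖) *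
          (K * exp (-b * Literature.Analysis.FluidPDE.configEnergy Zs)) :=
        Finset.sum_le_sum fun i _ => abs_hsCollisionTerm_le_weighted G 0 i hb hg Zs
    _ = _ := by
        rw [← Finset.sum_mul, ← Finset.mul_sum, Finset.sum_add_distrib, Finset.sum_const,
          Finset.card_univ, Fintype.card_fin, nsmul_eq_mul]

/-- **BGSR (4.11) for the BBGKY collision operator** `C_{k,k+1} = (N - k) ε^{d-1} ∑_{i<k}
C^i_{k,k+1}` (tree normalisation, GST (4.3.5)), `ε ≥ 0`: if `|g| ≤ K e^{-λ H_{k+1}}` then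
`|C_{k,k+1} g (Z_k)| ≤ N ε^{d-1} C_d λ^{-d/2} (k λ^{-1/2} + ∑_{i<k} |v_i|) K e^{-λ H_k(Z_k)}`
(BGSR (3.4) carry an extra `α^{-1}`, so that their prefactor is `(N-k)ε^{d-1}α^{-1} ≤ 1`).
[cite: BodineauGallagherSaintRaymondInvent2016, §4.2 (4.11), pp. 11–12] -/
theorem abs_bbgkyOp_le_weighted (G : Literature.Analysis.FluidPDE.Geometry d X) {ε : ℝ} (hε : 0 ≤ ε) (N s : ℕ) {K b : ℝ}
    (hb : 0 < b) {g : Literature.Analysis.FluidPDE.Config (s + 1) d X → ℝ} (hg : ∀ Z, |g Z| ≤ K * exp (-b * Literature.Analysis.FluidPDE.configEnergy Z))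
    (Zs : Literature.Analysis.FluidPDE.Config s d X) :
    |Literature.Analysis.FluidPDE.bbgkyOp G ε N s g Zs| ≤
      ((N * ε ^ (Fintype.card d - 1)) *
        ((∫ u : EuclideanSpace ℝ d, (1 + ‖u‖) * exp (-(1 / 2) * ‖u‖ ^ 2)) *
          (KineticTheory.sphereMeasure : Measure (sphere (0 : EuclideanSpace ℝ d) 1)).real univ)) *
        (sqrt b ^ Fintype.card d)⁻¹ * (s * (sqrt b)⁻¹ + ∑ i, ‖(Zs i).2‖) *
        (K * exp (-b * Literature.Analysis.FluidPDE.configEnergy Zs)) := by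
  set C := (∫ u : EuclideanSpace ℝ d, (1 + ‖u‖) * exp (-(1 / 2) * ‖u‖ ^ 2)) *
    (KineticTheory.sphereMeasure : Measure (sphere (0 : EuclideanSpace ℝ d) 1)).real univ with hC
  have hpref : |((N - s : ℕ) : ℝ) * ε ^ (Fintype.card d - 1)| ≤ N * ε ^ (Fintype.card d - 1) := by
    rw [abs_of_nonneg (by positivity)]
    gcongr
    exact_mod_cast Nat.sub_le N s
  unfold Literature.Analysis.FluidPDE.bbgkyOp Literature.Analysis.FluidPDE.bbgkyCollisionOp
  calc |∑ i : Fin s, ((N - s : ℕ) : ℝ) * ε ^ (Fintype.card d - 1) * Literature.Analysis.FluidPDE.hsCollisionTerm G ε s i g Zs|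
      ≤ ∑ i : Fin s,
          |((N - s : ℕ) : ℝ) * ε ^ (Fintype.card d - 1) * Literature.Analysis.FluidPDE.hsCollisionTerm G ε s i g Zs| :=
        Finset.abs_sum_le_sum_abs _ _
    _ = ∑ i : Fin s, |((N - s : ℕ) : ℝ) * ε ^ (Fintype.card d - 1)| *
          |Literature.Analysis.FluidPDE.hsCollisionTerm G ε s i g Zs| := Finset.sum_congr rfl fun i _ => abs_mul _ _
    _ ≤ ∑ i : Fin s, (N * ε ^ (Fintype.card d - 1)) *
          (C * (sqrt b ^ Fintype.card d)⁻¹ * ((sqrt b)⁻¹ + ‖(Zs i).2‖) *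
            (K * exp (-b * Literature.Analysis.FluidPDE.configEnergy Zs))) :=
        Finset.sum_le_sum fun i _ => mul_le_mul hpref (abs_hsCollisionTerm_le_weighted G ε i hb hg Zs)
          (abs_nonneg _) (by positivity)
    _ = _ := by
        rw [← Finset.mul_sum, ← Finset.sum_mul, ← Finset.mul_sum, Finset.sum_add_distrib,
          Finset.sum_const, Finset.card_univ, Fintype.card_fin, nsmul_eq_mul]
        ring

end SingleStep

/-! ## Absorbing the velocity moment by a fraction of the weight -/

section Moment

omit [Fintype d] in
/-- `(∑_{i<k} |v_i|) e^{-δ H_k(Z_k)} ≤ (k/δ)^{1/2}` for `δ > 0`: by Cauchy–Schwarz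
`(∑ |v_i|)² ≤ k ∑ |v_i|² = 2k H_k`, and `x e^{-x} ≤ 1` with `x = 2δ H_k` (BGSR p. 12 display,
with `δ = λ/2n`, up to the factor `e^{-1/2}`). [folklore] -/
theorem sum_norm_mul_exp_neg_mul_configEnergy_le [Fintype d] {k : ℕ} (Z : Literature.Analysis.FluidPDE.Config k d X)
    {δ : ℝ} (hδ : 0 < δ) :
    (∑ i, ‖(Z i).2‖) * exp (-δ * Literature.Analysis.FluidPDE.configEnergy Z) ≤ sqrt (k / δ) := by
  set S := ∑ i, ‖(Z i).2‖ with hS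
  have hE : 0 ≤ Literature.Analysis.FluidPDE.configEnergy Z := by unfold Literature.Analysis.FluidPDE.configEnergy; positivity
  have hCS : S ^ 2 ≤ k * (2 * Literature.Analysis.FluidPDE.configEnergy Z) := by
    have h := sq_sum_le_card_mul_sum_sq (s := (Finset.univ : Finset (Fin k)))
      (f := fun i => ‖(Z i).2‖)
    simp only [Finset.card_univ, Fintype.card_fin] at h
    have h2 : (2 : ℝ) * Literature.Analysis.FluidPDE.configEnergy Z = ∑ i, ‖(Z i).2‖ ^ 2 := by
      unfold Literature.Analysis.FluidPDE.configEnergy; ring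
    rw [h2]
    exact h
  refine Real.le_sqrt_of_sq_le ?_
  have hx : (2 * δ * Literature.Analysis.FluidPDE.configEnergy Z) * exp (-(2 * δ * Literature.Analysis.FluidPDE.configEnergy Z)) ≤ 1 := by
    have h1 := Real.add_one_le_exp (2 * δ * Literature.Analysis.FluidPDE.configEnergy Z)
    rw [Real.exp_neg, mul_inv_le_iff₀ (exp_pos _), one_mul]
    linarith
  have hkδ : 0 ≤ (k : ℝ) / δ := by positivity
  calc (S * exp (-δ * Literature.Analysis.FluidPDE.configEnergy Z)) ^ 2 = S ^ 2 * exp (-(2 * δ * Literature.Analysis.FluidPDE.configEnergy Z)) := by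
        rw [mul_pow, sq (exp _), ← Real.exp_add]
        congr 2
        ring
    _ ≤ (k * (2 * Literature.Analysis.FluidPDE.configEnergy Z)) * exp (-(2 * δ * Literature.Analysis.FluidPDE.configEnergy Z)) := by gcongr
    _ = k / δ * ((2 * δ * Literature.Analysis.FluidPDE.configEnergy Z) * exp (-(2 * δ * Literature.Analysis.FluidPDE.configEnergy Z))) := by
        field_simp
    _ ≤ k / δ * 1 := by gcongr
    _ = k / δ := mul_one _

end Moment

/-! ## Piling the inequalities: the abstract chain estimate -/

section Chain

/-- **The induction behind BGSR Lemma 4.2, for an abstract Duhamel chain.** Let `T_s` be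
transports that are compositions with energy-preserving maps of the `s`-particle phase space,
`C_s` collision operators satisfying the single-step weighted estimate (4.11) with constant
`A` (`abs_boltzmannHOp_le_weighted`, `abs_bbgkyOp_le_weighted`), and `R n s t` any family
obeying the Duhamel recursion `R (n+1) s t = ∫_0^t T_s(t - τ) C_s (R n (s+1) τ) dτ`. Fix a
floor `λ_m > 0` for the weights, a decrement `δ > 0` per collision operator and a bound `k_max`
on the particle numbers at which collision operators act. If the innermost slot satisfies
`|R 0 (s+n) τ| ≤ K e^{-(λ₀ + nδ) H_{s+n}}` for `τ ∈ [0, T]`, with `λ₀ ≥ λ_m`, `K ≥ 0`,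
`s + n ≤ k_max + 1`, then for `t ∈ [0, T]`
`|R n s t (Z_s)| ≤ K Λⁿ tⁿ/n! e^{-λ₀ H_s(Z_s)}`,
`Λ = A λ_m^{-d/2} (k_max λ_m^{-1/2} + (k_max/δ)^{1/2})`: each collision operator costs a factor
`Λ` and a loss `δ` on the weight (`sum_norm_mul_exp_neg_mul_configEnergy_le`), the transports
cost nothing, and the ordered time integrals give `tⁿ/n!` ("piling together those inequalities
(distributing the exponential weight evenly on each occurence of a collision term)", BGSR
p. 12). No measurability is needed: only upper bounds of interval integrals by polynomial
majorants are taken. The level `s + n` is passed as a free index `m = s + n` to avoid casts.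
[cite: BodineauGallagherSaintRaymondInvent2016, §4.2, proof of Lemma 4.2, pp. 11–12] -/
theorem abs_duhamelChain_le_weighted
    {transport : (s : ℕ) → ℝ → (Literature.Analysis.FluidPDE.Config s d X → ℝ) → Literature.Analysis.FluidPDE.Config s d X → ℝ}
    (htr : ∀ (s : ℕ) (t : ℝ) (g : Literature.Analysis.FluidPDE.Config s d X → ℝ) (Z : Literature.Analysis.FluidPDE.Config s d X),
      ∃ Z' : Literature.Analysis.FluidPDE.Config s d X, Literature.Analysis.FluidPDE.configEnergy Z' = Literature.Analysis.FluidPDE.configEnergy Z ∧ transport s t g Z = g Z')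
    {op : (s : ℕ) → (Literature.Analysis.FluidPDE.Config (s + 1) d X → ℝ) → Literature.Analysis.FluidPDE.Config s d X → ℝ} {A : ℝ} (hA : 0 ≤ A)
    (hop : ∀ (k : ℕ) (g : Literature.Analysis.FluidPDE.Config (k + 1) d X → ℝ) (K b : ℝ), 0 < b → 0 ≤ K →
      (∀ Z, |g Z| ≤ K * exp (-b * Literature.Analysis.FluidPDE.configEnergy Z)) →
      ∀ Z : Literature.Analysis.FluidPDE.Config k d X, |op k g Z| ≤
        A * (sqrt b ^ Fintype.card d)⁻¹ * (k * (sqrt b)⁻¹ + ∑ i, ‖(Z i).2‖) *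
          (K * exp (-b * Literature.Analysis.FluidPDE.configEnergy Z)))
    (R : ℕ → (s : ℕ) → ℝ → Literature.Analysis.FluidPDE.Config s d X → ℝ)
    (hR : ∀ (n s : ℕ) (t : ℝ) (Z : Literature.Analysis.FluidPDE.Config s d X),
      R (n + 1) s t Z = ∫ τ in (0 : ℝ)..t, transport s (t - τ) (op s (R n (s + 1) τ)) Z)
    {T bm δ : ℝ} (hT : 0 ≤ T) (hbm : 0 < bm) (hδ : 0 < δ) (kmax : ℕ) :
    ∀ (n s m : ℕ), m = s + n → m ≤ kmax + 1 → ∀ {b₀ : ℝ}, bm ≤ b₀ → ∀ {K : ℝ}, 0 ≤ K →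
      (∀ τ ∈ Icc 0 T, ∀ Z : Literature.Analysis.FluidPDE.Config m d X,
        |R 0 m τ Z| ≤ K * exp (-(b₀ + n * δ) * Literature.Analysis.FluidPDE.configEnergy Z)) →
      ∀ t ∈ Icc 0 T, ∀ Z : Literature.Analysis.FluidPDE.Config s d X,
        |R n s t Z| ≤
          K * (A * (sqrt bm ^ Fintype.card d)⁻¹ * (kmax * (sqrt bm)⁻¹ + sqrt (kmax / δ))) ^ n *
            t ^ n / n ! * exp (-b₀ * Literature.Analysis.FluidPDE.configEnergy Z) := by
  have _ := hT
  set Λ := A * (sqrt bm ^ Fintype.card d)⁻¹ * (kmax * (sqrt bm)⁻¹ + sqrt (kmax / δ)) with hΛ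
  have hsbm : 0 < sqrt bm := sqrt_pos.2 hbm
  have hΛ0 : 0 ≤ Λ := by positivity
  intro n
  induction n with
  | zero =>
    intro s m hm _ b₀ _ K _ hin t ht Z
    obtain rfl : m = s := by simpa using hm
    simpa using hin t ht Z
  | succ n ih =>
    intro s m hm hmk b₀ hb₀ K hK hin t ht Z
    have hsk : s ≤ kmax := by omega
    have hb₁ : 0 < b₀ + δ := by linarith
    -- the induction hypothesis at level `s + 1`, final weight `b₀ + δ`
    have hin' : ∀ τ ∈ Icc 0 T, ∀ Z : Literature.Analysis.FluidPDE.Config m d X,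
        |R 0 m τ Z| ≤ K * exp (-((b₀ + δ) + n * δ) * Literature.Analysis.FluidPDE.configEnergy Z) := by
      intro τ hτ Z
      convert hin τ hτ Z using 3
      push_cast
      ring
    have hIH := ih (s + 1) m (by omega) hmk (b₀ := b₀ + δ) (by linarith) hK hin'
    -- pointwise bound on the integrand of the last Duhamel integral
    have hpt : ∀ τ ∈ Ioc 0 t, ∀ Z : Literature.Analysis.FluidPDE.Config s d X,
        |transport s (t - τ) (op s (R n (s + 1) τ)) Z| ≤
          Λ * (K * Λ ^ n * τ ^ n / n !) * exp (-b₀ * Literature.Analysis.FluidPDE.configEnergy Z) := by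
      intro τ hτ Z
      have hτ0 : 0 ≤ τ := hτ.1.le
      have hτT : τ ∈ Icc 0 T := ⟨hτ0, hτ.2.trans ht.2⟩
      set Kτ := K * Λ ^ n * τ ^ n / n ! with hKτ
      have hKτ0 : 0 ≤ Kτ := by positivity
      have hg : ∀ Z' : Literature.Analysis.FluidPDE.Config (s + 1) d X,
          |R n (s + 1) τ Z'| ≤ Kτ * exp (-(b₀ + δ) * Literature.Analysis.FluidPDE.configEnergy Z') := fun Z' => hIH τ hτT Z'
      obtain ⟨Z', hE', hZ'⟩ := htr s (t - τ) (op s (R n (s + 1) τ)) Z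
      rw [hZ', ← hE']
      refine (hop s (R n (s + 1) τ) Kτ (b₀ + δ) hb₁ hKτ0 hg Z').trans ?_
      -- one collision operator costs `Λ` and the weight `δ`
      have hsb : sqrt bm ≤ sqrt (b₀ + δ) := sqrt_le_sqrt (by linarith)
      have h1 : (sqrt (b₀ + δ) ^ Fintype.card d)⁻¹ ≤ (sqrt bm ^ Fintype.card d)⁻¹ := by
        apply inv_anti₀ (pow_pos hsbm _)
        exact pow_le_pow_left₀ hsbm.le hsb _
      have h2 : (s * (sqrt (b₀ + δ))⁻¹ + ∑ i, ‖(Z' i).2‖) * exp (-δ * Literature.Analysis.FluidPDE.configEnergy Z') ≤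
          kmax * (sqrt bm)⁻¹ + sqrt (kmax / δ) := by
        have hmom := sum_norm_mul_exp_neg_mul_configEnergy_le Z' hδ
        have hexp1 : exp (-δ * Literature.Analysis.FluidPDE.configEnergy Z') ≤ 1 := by
          apply exp_le_one_iff.2
          have : 0 ≤ Literature.Analysis.FluidPDE.configEnergy Z' := by unfold Literature.Analysis.FluidPDE.configEnergy; positivity
          nlinarith
        have hsk' : (s : ℝ) ≤ kmax := by exact_mod_cast hsk
        have hinv : (sqrt (b₀ + δ))⁻¹ ≤ (sqrt bm)⁻¹ := inv_anti₀ hsbm hsb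
        have hsq : sqrt (s / δ) ≤ sqrt (kmax / δ) := sqrt_le_sqrt (by gcongr)
        rw [add_mul]
        refine add_le_add ?_ (hmom.trans hsq)
        calc (s : ℝ) * (sqrt (b₀ + δ))⁻¹ * exp (-δ * Literature.Analysis.FluidPDE.configEnergy Z')
            ≤ (s : ℝ) * (sqrt (b₀ + δ))⁻¹ * 1 := by gcongr
          _ = (s : ℝ) * (sqrt (b₀ + δ))⁻¹ := mul_one _
          _ ≤ kmax * (sqrt bm)⁻¹ := by gcongr
      have hexp : exp (-(b₀ + δ) * Literature.Analysis.FluidPDE.configEnergy Z') =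
          exp (-δ * Literature.Analysis.FluidPDE.configEnergy Z') * exp (-b₀ * Literature.Analysis.FluidPDE.configEnergy Z') := by
        rw [← Real.exp_add]
        congr 1
        ring
      calc A * (sqrt (b₀ + δ) ^ Fintype.card d)⁻¹ * (s * (sqrt (b₀ + δ))⁻¹ + ∑ i, ‖(Z' i).2‖) *
            (Kτ * exp (-(b₀ + δ) * Literature.Analysis.FluidPDE.configEnergy Z'))
          = A * (sqrt (b₀ + δ) ^ Fintype.card d)⁻¹ *
              ((s * (sqrt (b₀ + δ))⁻¹ + ∑ i, ‖(Z' i).2‖) * exp (-δ * Literature.Analysis.FluidPDE.configEnergy Z')) *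
              (Kτ * exp (-b₀ * Literature.Analysis.FluidPDE.configEnergy Z')) := by rw [hexp]; ring
        _ ≤ A * (sqrt bm ^ Fintype.card d)⁻¹ * (kmax * (sqrt bm)⁻¹ + sqrt (kmax / δ)) *
              (Kτ * exp (-b₀ * Literature.Analysis.FluidPDE.configEnergy Z')) := by gcongr
        _ = Λ * Kτ * exp (-b₀ * Literature.Analysis.FluidPDE.configEnergy Z') := by rw [hΛ]; ring
        _ = Λ * (K * Λ ^ n * τ ^ n / n !) * exp (-b₀ * Literature.Analysis.FluidPDE.configEnergy Z') := by rw [hKτ]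
    -- integrate in time
    rw [hR]
    have hcont : Continuous fun τ : ℝ => Λ * (K * Λ ^ n * τ ^ n / n !) * exp (-b₀ * Literature.Analysis.FluidPDE.configEnergy Z) := by
      fun_prop
    have hle := intervalIntegral.norm_integral_le_of_norm_le ht.1
      (Eventually.of_forall fun τ hτ => (Real.norm_eq_abs _).le.trans (hpt τ hτ Z))
      (hcont.intervalIntegrable (μ := volume) 0 t)
    rw [Real.norm_eq_abs] at hle
    refine hle.trans_eq ?_
    have hfun : (fun τ : ℝ => Λ * (K * Λ ^ n * τ ^ n / n !) * exp (-b₀ * Literature.Analysis.FluidPDE.configEnergy Z)) =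
        fun τ : ℝ => (Λ * K * Λ ^ n / n ! * exp (-b₀ * Literature.Analysis.FluidPDE.configEnergy Z)) * τ ^ n := by
      funext τ
      ring
    rw [hfun, intervalIntegral.integral_const_mul, integral_pow, zero_pow (Nat.succ_ne_zero n),
      sub_zero, pow_succ, Nat.factorial_succ]
    push_cast
    field_simp
    ring

/-- **The chain estimate for the Duhamel terms `Q_{s,s+n}(t) F₀`** (`Kinetic.duhamelTerm`,
innermost slot `T_{s+n}(τ) F₀^{(s+n)}`): under the hypotheses of
`abs_duhamelChain_le_weighted` on the transports and collision operators, if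
`|F₀^{(s+n)}| ≤ K e^{-(λ₀ + nδ) H_{s+n}}` then for `t ≥ 0`
`|Q_{s,s+n}(t) F₀ (Z_s)| ≤ K Λⁿ tⁿ/n! e^{-λ₀ H_s(Z_s)}`.
[cite: BodineauGallagherSaintRaymondInvent2016, §4.2, proof of Lemma 4.2, pp. 11–12] -/
theorem abs_duhamelTerm_le_weighted
    {transport : (s : ℕ) → ℝ → (Literature.Analysis.FluidPDE.Config s d X → ℝ) → Literature.Analysis.FluidPDE.Config s d X → ℝ}
    (htr : ∀ (s : ℕ) (t : ℝ) (g : Literature.Analysis.FluidPDE.Config s d X → ℝ) (Z : Literature.Analysis.FluidPDE.Config s d X),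
      ∃ Z' : Literature.Analysis.FluidPDE.Config s d X, Literature.Analysis.FluidPDE.configEnergy Z' = Literature.Analysis.FluidPDE.configEnergy Z ∧ transport s t g Z = g Z')
    {op : (s : ℕ) → (Literature.Analysis.FluidPDE.Config (s + 1) d X → ℝ) → Literature.Analysis.FluidPDE.Config s d X → ℝ} {A : ℝ} (hA : 0 ≤ A)
    (hop : ∀ (k : ℕ) (g : Literature.Analysis.FluidPDE.Config (k + 1) d X → ℝ) (K b : ℝ), 0 < b → 0 ≤ K →
      (∀ Z, |g Z| ≤ K * exp (-b * Literature.Analysis.FluidPDE.configEnergy Z)) →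
      ∀ Z : Literature.Analysis.FluidPDE.Config k d X, |op k g Z| ≤
        A * (sqrt b ^ Fintype.card d)⁻¹ * (k * (sqrt b)⁻¹ + ∑ i, ‖(Z i).2‖) *
          (K * exp (-b * Literature.Analysis.FluidPDE.configEnergy Z)))
    {bm δ : ℝ} (hbm : 0 < bm) (hδ : 0 < δ) (kmax n s : ℕ) (hk : s + n ≤ kmax + 1)
    {b₀ : ℝ} (hb₀ : bm ≤ b₀) {K : ℝ} (hK : 0 ≤ K) (F₀ : Literature.Analysis.FluidPDE.GCState d X)
    (hF : ∀ Z : Literature.Analysis.FluidPDE.Config (s + n) d X, |F₀ (s + n) Z| ≤ K * exp (-(b₀ + n * δ) * Literature.Analysis.FluidPDE.configEnergy Z))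
    {t : ℝ} (ht : 0 ≤ t) (Z : Literature.Analysis.FluidPDE.Config s d X) :
    |Literature.Analysis.FluidPDE.duhamelTerm transport op n s t F₀ Z| ≤
      K * (A * (sqrt bm ^ Fintype.card d)⁻¹ * (kmax * (sqrt bm)⁻¹ + sqrt (kmax / δ))) ^ n *
        t ^ n / n ! * exp (-b₀ * Literature.Analysis.FluidPDE.configEnergy Z) := by
  refine abs_duhamelChain_le_weighted htr hA hop (fun n s t => Literature.Analysis.FluidPDE.duhamelTerm transport op n s t F₀)
    (fun n s t Z => Literature.Analysis.FluidPDE.duhamelTerm_succ transport op n s t F₀ Z) ht hbm hδ kmax n s (s + n) rfl hk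
    hb₀ hK (fun τ _ Z => ?_) t ⟨ht, le_rfl⟩ Z
  rw [Literature.Analysis.FluidPDE.duhamelTerm_zero]
  obtain ⟨Z', hE', hZ'⟩ := htr (s + n) τ (F₀ (s + n)) Z
  rw [hZ', ← hE']
  exact hF Z'

end Chain

/-! ## The printed constants -/

section Constants

/-- With the choices of the printed proof — floor `λ/2`, decrement `δ = λ/2n`, `k_max = s+n-1`
— the cost of one collision operator is `Λ ≤ A 2^{(d+3)/2} (s+n) / λ^{(d+1)/2}` ("each
collision operator gives therefore a loss of `C λ^{-(d+1)/2} (s+n)`", BGSR p. 12). [folklore] -/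
theorem chainConst_le {A lam : ℝ} (hA : 0 ≤ A) (hlam : 0 < lam) (s n D : ℕ) :
    A * (sqrt (lam / 2) ^ D)⁻¹ *
        ((s + n - 1 : ℕ) * (sqrt (lam / 2))⁻¹ + sqrt ((s + n - 1 : ℕ) / (lam / (2 * n)))) ≤
      A * sqrt 2 ^ (D + 3) / sqrt lam ^ (D + 1) * (s + n : ℕ) := by
  have hs2 : 0 < sqrt 2 := by positivity
  have hsl : 0 < sqrt lam := sqrt_pos.2 hlam
  have hk : ((s + n - 1 : ℕ) : ℝ) ≤ (s + n : ℕ) := by exact_mod_cast Nat.sub_le _ _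
  have hsqrt_half : sqrt (lam / 2) = sqrt lam / sqrt 2 := by
    rw [sqrt_div' _ zero_le_two]
  have hΛ1 : (sqrt (lam / 2) ^ D)⁻¹ = sqrt 2 ^ D / sqrt lam ^ D := by
    rw [hsqrt_half, div_pow, inv_div]
  have hΛ2 : ((s + n - 1 : ℕ) : ℝ) * (sqrt (lam / 2))⁻¹ ≤ (s + n : ℕ) * (sqrt 2 / sqrt lam) := by
    rw [hsqrt_half, inv_div]
    gcongr
  have hΛ3 : sqrt (((s + n - 1 : ℕ) : ℝ) / (lam / (2 * n))) ≤ (s + n : ℕ) * (sqrt 2 / sqrt lam) := by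
    have hnk : (n : ℝ) * ((s + n - 1 : ℕ) : ℝ) ≤ ((s + n : ℕ) : ℝ) ^ 2 := by
      have h1 : (n : ℝ) ≤ (s + n : ℕ) := by push_cast; linarith [(Nat.cast_nonneg s : (0 : ℝ) ≤ s)]
      calc (n : ℝ) * ((s + n - 1 : ℕ) : ℝ) ≤ (s + n : ℕ) * (s + n : ℕ) := by gcongr
        _ = ((s + n : ℕ) : ℝ) ^ 2 := by ring
    have heq : ((s + n - 1 : ℕ) : ℝ) / (lam / (2 * n)) = 2 * (n * ((s + n - 1 : ℕ) : ℝ)) / lam := by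
      field_simp
    rw [heq]
    calc sqrt (2 * (n * ((s + n - 1 : ℕ) : ℝ)) / lam)
        ≤ sqrt (2 * ((s + n : ℕ) : ℝ) ^ 2 / lam) := sqrt_le_sqrt (by gcongr)
      _ = (s + n : ℕ) * (sqrt 2 / sqrt lam) := by
          rw [sqrt_div' _ hlam.le, sqrt_mul' _ (sq_nonneg _), sqrt_sq (Nat.cast_nonneg _)]
          ring
  calc A * (sqrt (lam / 2) ^ D)⁻¹ *
        ((s + n - 1 : ℕ) * (sqrt (lam / 2))⁻¹ + sqrt ((s + n - 1 : ℕ) / (lam / (2 * n))))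
      ≤ A * (sqrt 2 ^ D / sqrt lam ^ D) *
          ((s + n : ℕ) * (sqrt 2 / sqrt lam) + (s + n : ℕ) * (sqrt 2 / sqrt lam)) := by
        rw [hΛ1]
        gcongr
    _ = A * sqrt 2 ^ (D + 3) / sqrt lam ^ (D + 1) * (s + n : ℕ) := by
        have h2 : sqrt 2 ^ (D + 3) = sqrt 2 ^ D * (sqrt 2 * (sqrt 2) ^ 2) := by ring
        rw [h2, sq_sqrt zero_le_two]
        field_simp
        ring

/-- The time-simplex and Stirling step of the printed proof: for `n ≥ 1`, `t ≥ 0`,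
`(Λ' (s+n))ⁿ tⁿ/n! ≤ e^{s-1} (e² Λ' t)ⁿ`, from `(s+n)ⁿ/n! ≤ e^{s+n}`
(`Real.pow_div_factorial_le_exp`; "By Stirling's formula, we have `(s+n)ⁿ/n! ≤ exp(s+n)`",
BGSR p. 12). [folklore] -/
theorem pow_chainConst_mul_le {Λ' t : ℝ} (hΛ : 0 ≤ Λ') (ht : 0 ≤ t) (s n : ℕ) (hn : 1 ≤ n) :
    (Λ' * (s + n : ℕ)) ^ n * t ^ n / n ! ≤ exp (s - 1) * (exp 2 * Λ' * t) ^ n := by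
  have hst := Real.pow_div_factorial_le_exp (x := ((s + n : ℕ) : ℝ)) (Nat.cast_nonneg _) n
  have hexp : exp ((s + n : ℕ) : ℝ) ≤ exp (s - 1) * exp 2 ^ n := by
    rw [← Real.exp_nat_mul, ← Real.exp_add]
    apply exp_le_exp.2
    push_cast
    have : (1 : ℝ) ≤ n := by exact_mod_cast hn
    linarith
  calc (Λ' * (s + n : ℕ)) ^ n * t ^ n / n ! = (Λ' * t) ^ n * (((s + n : ℕ) : ℝ) ^ n / n !) := by
        rw [mul_pow, mul_pow]; ring
    _ ≤ (Λ' * t) ^ n * exp ((s + n : ℕ) : ℝ) := by gcongr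
    _ ≤ (Λ' * t) ^ n * (exp (s - 1) * exp 2 ^ n) := by gcongr
    _ = exp (s - 1) * (exp 2 * Λ' * t) ^ n := by rw [mul_pow, mul_pow, mul_pow]; ring

/-- Combination of `chainConst_le` and `pow_chainConst_mul_le`: the raw chain constant of
`abs_duhamelChain_le_weighted` with the printed choices is bounded by
`e^{s-1} (C t / λ^{(d+1)/2})ⁿ`, `C = e² 2^{(d+3)/2} A`, for `n ≥ 1`. [folklore] -/
theorem chainConst_pow_le {A lam t : ℝ} (hA : 0 ≤ A) (hlam : 0 < lam) (ht : 0 ≤ t)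
    (s n D : ℕ) (hn : 1 ≤ n) :
    (A * (sqrt (lam / 2) ^ D)⁻¹ *
          ((s + n - 1 : ℕ) * (sqrt (lam / 2))⁻¹ + sqrt ((s + n - 1 : ℕ) / (lam / (2 * n))))) ^ n *
        t ^ n / n ! ≤
      exp (s - 1) * (exp 2 * sqrt 2 ^ (D + 3) * A * t / sqrt lam ^ (D + 1)) ^ n := by
  have hsl : 0 < sqrt lam := sqrt_pos.2 hlam
  set Λ' := A * sqrt 2 ^ (D + 3) / sqrt lam ^ (D + 1) with hΛ'
  have hΛ'0 : 0 ≤ Λ' := by positivity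
  have h1 := chainConst_le hA hlam s n D
  have h0 : 0 ≤ A * (sqrt (lam / 2) ^ D)⁻¹ *
      ((s + n - 1 : ℕ) * (sqrt (lam / 2))⁻¹ + sqrt ((s + n - 1 : ℕ) / (lam / (2 * n)))) := by
    positivity
  calc _ ≤ (Λ' * (s + n : ℕ)) ^ n * t ^ n / n ! := by gcongr
    _ ≤ exp (s - 1) * (exp 2 * Λ' * t) ^ n := pow_chainConst_mul_le hΛ'0 ht s n hn
    _ = exp (s - 1) * (exp 2 * sqrt 2 ^ (D + 3) * A * t / sqrt lam ^ (D + 1)) ^ n := by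
        rw [hΛ']
        congr 2
        field_simp

end Constants

/-! ## BGSR Lemma 4.2 -/

section Lemma42

/-- **Weighted estimate for the Boltzmann Duhamel terms, raw form** (free transport, `C⁰`):
with `C_d = J_d |S^{d-1}|`, floor `λ_m`, decrement `δ`, particle bound `k_max`, if
`|F₀^{(s+n)}| ≤ K e^{-(λ₀ + nδ) H}` then
`|Q⁰_{s,s+n}(t) F₀ (Z_s)| ≤ K Λⁿ tⁿ/n! e^{-λ₀ H_s(Z_s)}`, `t ≥ 0` (no hypothesis on the geometry).
[cite: BodineauGallagherSaintRaymondInvent2016, §4.2, proof of Lemma 4.2, pp. 11–12] -/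
theorem abs_boltzmannDuhamelTerm_le_weighted (G : Literature.Analysis.FluidPDE.Geometry d X) {bm δ : ℝ} (hbm : 0 < bm)
    (hδ : 0 < δ) (kmax n s : ℕ) (hk : s + n ≤ kmax + 1) {b₀ : ℝ} (hb₀ : bm ≤ b₀) {K : ℝ}
    (hK : 0 ≤ K) (F₀ : Literature.Analysis.FluidPDE.GCState d X)
    (hF : ∀ Z : Literature.Analysis.FluidPDE.Config (s + n) d X, |F₀ (s + n) Z| ≤ K * exp (-(b₀ + n * δ) * Literature.Analysis.FluidPDE.configEnergy Z))
    {t : ℝ} (ht : 0 ≤ t) (Z : Literature.Analysis.FluidPDE.Config s d X) :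
    |Literature.Analysis.FluidPDE.boltzmannDuhamelTerm G n s t F₀ Z| ≤
      K * (((∫ u : EuclideanSpace ℝ d, (1 + ‖u‖) * exp (-(1 / 2) * ‖u‖ ^ 2)) *
              (KineticTheory.sphereMeasure : Measure (sphere (0 : EuclideanSpace ℝ d) 1)).real univ) *
            (sqrt bm ^ Fintype.card d)⁻¹ * (kmax * (sqrt bm)⁻¹ + sqrt (kmax / δ))) ^ n *
        t ^ n / n ! * exp (-b₀ * Literature.Analysis.FluidPDE.configEnergy Z) := by
  haveI := Literature.Analysis.FluidPDE.isFiniteMeasure_sphereMeasure (E := EuclideanSpace ℝ d)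
  have hJ : 0 ≤ ∫ u : EuclideanSpace ℝ d, (1 + ‖u‖) * exp (-(1 / 2) * ‖u‖ ^ 2) :=
    integral_nonneg fun u => by positivity
  have hA : 0 ≤ (∫ u : EuclideanSpace ℝ d, (1 + ‖u‖) * exp (-(1 / 2) * ‖u‖ ^ 2)) *
      (KineticTheory.sphereMeasure : Measure (sphere (0 : EuclideanSpace ℝ d) 1)).real univ :=
    mul_nonneg hJ measureReal_nonneg
  exact abs_duhamelTerm_le_weighted (transport := Literature.Analysis.FluidPDE.freeTransport G) (op := Literature.Analysis.FluidPDE.boltzmannHOp G)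
    (fun s t g Z => ⟨Literature.Analysis.FluidPDE.freeFlight G (-t) Z, Literature.Analysis.FluidPDE.configEnergy_freeFlight G (-t) Z, rfl⟩) hA
    (fun k g K b hb _ hg Z => abs_boltzmannHOp_le_weighted G k hb hg Z) hbm hδ kmax n s hk hb₀ hK
    F₀ hF ht Z

/-- **Weighted estimate for the BBGKY Duhamel terms, raw form** (hard-sphere transports along
flows `Φ^s` conserving the kinetic energy, `C_{s,s+1}` with prefactor `(N-s)ε^{d-1}`, `ε ≥ 0`):
with `A = N ε^{d-1} C_d`, if `|F₀^{(s+n)}| ≤ K e^{-(λ₀ + nδ) H}` then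
`|Q_{s,s+n}(t) F₀ (Z_s)| ≤ K Λⁿ tⁿ/n! e^{-λ₀ H_s(Z_s)}`, `t ≥ 0`.
[cite: BodineauGallagherSaintRaymondInvent2016, §4.2, proof of Lemma 4.2, pp. 11–12] -/
theorem abs_bbgkyDuhamelTerm_le_weighted [MeasureSpace X] [TopologicalSpace X]
    (G : Literature.Analysis.FluidPDE.Geometry d X) {ε : ℝ} (hε : 0 ≤ ε) (N : ℕ) (Φ : (s : ℕ) → Literature.Analysis.FluidPDE.HardSphereFlow G ε s)
    (hΦE : ∀ (s : ℕ) (t : ℝ) (z : Literature.Analysis.FluidPDE.Config s d X), Literature.Analysis.FluidPDE.configEnergy ((Φ s).flow t z) = Literature.Analysis.FluidPDE.configEnergy z)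
    {bm δ : ℝ} (hbm : 0 < bm) (hδ : 0 < δ) (kmax n s : ℕ) (hk : s + n ≤ kmax + 1) {b₀ : ℝ}
    (hb₀ : bm ≤ b₀) {K : ℝ} (hK : 0 ≤ K) (F₀ : Literature.Analysis.FluidPDE.GCState d X)
    (hF : ∀ Z : Literature.Analysis.FluidPDE.Config (s + n) d X, |F₀ (s + n) Z| ≤ K * exp (-(b₀ + n * δ) * Literature.Analysis.FluidPDE.configEnergy Z))
    {t : ℝ} (ht : 0 ≤ t) (Z : Literature.Analysis.FluidPDE.Config s d X) :
    |Literature.Analysis.FluidPDE.bbgkyDuhamelTerm G ε N Φ n s t F₀ Z| ≤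
      K * (((N * ε ^ (Fintype.card d - 1)) *
              ((∫ u : EuclideanSpace ℝ d, (1 + ‖u‖) * exp (-(1 / 2) * ‖u‖ ^ 2)) *
                (KineticTheory.sphereMeasure : Measure (sphere (0 : EuclideanSpace ℝ d) 1)).real univ)) *
            (sqrt bm ^ Fintype.card d)⁻¹ * (kmax * (sqrt bm)⁻¹ + sqrt (kmax / δ))) ^ n *
        t ^ n / n ! * exp (-b₀ * Literature.Analysis.FluidPDE.configEnergy Z) := by
  haveI := Literature.Analysis.FluidPDE.isFiniteMeasure_sphereMeasure (E := EuclideanSpace ℝ d)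
  have hJ : 0 ≤ ∫ u : EuclideanSpace ℝ d, (1 + ‖u‖) * exp (-(1 / 2) * ‖u‖ ^ 2) :=
    integral_nonneg fun u => by positivity
  have hA : 0 ≤ (N * ε ^ (Fintype.card d - 1)) *
      ((∫ u : EuclideanSpace ℝ d, (1 + ‖u‖) * exp (-(1 / 2) * ‖u‖ ^ 2)) *
        (KineticTheory.sphereMeasure : Measure (sphere (0 : EuclideanSpace ℝ d) 1)).real univ) :=
    mul_nonneg (by positivity) (mul_nonneg hJ measureReal_nonneg)
  exact abs_duhamelTerm_le_weighted (transport := fun s => Literature.Analysis.FluidPDE.hsTransport (Φ s))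
    (op := Literature.Analysis.FluidPDE.bbgkyOp G ε N)
    (fun s t g Z => ⟨(Φ s).flow (-t) Z, hΦE s (-t) Z, Literature.Analysis.FluidPDE.hsTransport_apply (Φ s) t g Z⟩) hA
    (fun k g K b hb _ hg Z => abs_bbgkyOp_le_weighted G hε N k hb hg Z) hbm hδ kmax n s hk hb₀ hK
    F₀ hF ht Z

/-- **BGSR Lemma 4.2, (4.10) (Boltzmann hierarchy).** There is a constant `C` depending only on
`d` such that, for every position space `X`, every geometry `G` on it, every `λ > 0`, all
`s ∈ ℕ`, `n ≥ 1`, `t ≥ 0` and every family `F₀` with `|F₀^{(s+n)}(Z)| ≤ B e^{-λ H_{s+n}(Z)}`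
(`B ≥ 0`, i.e. `‖F₀^{(s+n)}‖_{0,s+n,λ} ≤ B`), the Duhamel term of the Boltzmann hierarchy
satisfies `|Q⁰_{s,s+n}(t) F₀ (Z_s)| ≤ e^{s-1} (C t / λ^{(d+1)/2})ⁿ B e^{-(λ/2) H_s(Z_s)}`, i.e.
`‖Q⁰_{s,s+n}(t) F₀‖_{0,s,λ/2} ≤ e^{s-1} (C t/λ^{(d+1)/2})ⁿ ‖F₀^{(s+n)}‖_{0,s+n,λ}`; the proof
bounds the majorant `|Q⁰|_{s,s+n}(t) |F₀|` of the printed statement (gain and loss taken in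
absolute value), see the module docstring. `λ^{(d+1)/2} = (√λ)^{d+1}`.
[cite: BodineauGallagherSaintRaymondInvent2016, §4.2 Lemma 4.2 (4.10), p. 11] -/
theorem bgsr_lemma42_boltzmann (d : Type*) [Fintype d] :
    ∃ C : ℝ, 0 < C ∧ ∀ {X : Type u} (G : Literature.Analysis.FluidPDE.Geometry d X) {lam : ℝ},
      0 < lam → ∀ (s n : ℕ), 1 ≤ n → ∀ {t : ℝ}, 0 ≤ t → ∀ (F₀ : Literature.Analysis.FluidPDE.GCState d X) {B : ℝ}, 0 ≤ B →
      (∀ Z : Literature.Analysis.FluidPDE.Config (s + n) d X, |F₀ (s + n) Z| ≤ B * exp (-lam * Literature.Analysis.FluidPDE.configEnergy Z)) →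
      ∀ Z : Literature.Analysis.FluidPDE.Config s d X,
        |Literature.Analysis.FluidPDE.boltzmannDuhamelTerm G n s t F₀ Z| ≤
          exp (s - 1) * (C * t / sqrt lam ^ (Fintype.card d + 1)) ^ n * B *
            exp (-(lam / 2) * Literature.Analysis.FluidPDE.configEnergy Z) := by
  haveI := Literature.Analysis.FluidPDE.isFiniteMeasure_sphereMeasure (E := EuclideanSpace ℝ d)
  set A : ℝ := (∫ u : EuclideanSpace ℝ d, (1 + ‖u‖) * exp (-(1 / 2) * ‖u‖ ^ 2)) *
    (KineticTheory.sphereMeasure : Measure (sphere (0 : EuclideanSpace ℝ d) 1)).real univ with hAdef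
  have hJ : 0 ≤ ∫ u : EuclideanSpace ℝ d, (1 + ‖u‖) * exp (-(1 / 2) * ‖u‖ ^ 2) :=
    integral_nonneg fun u => by positivity
  have hA : 0 ≤ A := mul_nonneg hJ measureReal_nonneg
  refine ⟨exp 2 * sqrt 2 ^ (Fintype.card d + 3) * A + 1, by positivity, ?_⟩
  intro X G lam hlam s n hn t ht F₀ B hB hF Z
  -- the printed choices: floor `λ/2`, decrement `λ/2n`, `k_max = s + n - 1`
  have hn0 : (0 : ℝ) < n := by exact_mod_cast hn
  have hbm : 0 < lam / 2 := by positivity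
  have hδ : 0 < lam / (2 * n) := by positivity
  have hk : s + n ≤ (s + n - 1) + 1 := by omega
  have hF' : ∀ Z : Literature.Analysis.FluidPDE.Config (s + n) d X,
      |F₀ (s + n) Z| ≤ B * exp (-(lam / 2 + n * (lam / (2 * n))) * Literature.Analysis.FluidPDE.configEnergy Z) := by
    intro Z
    convert hF Z using 3
    field_simp
    ring
  have h := abs_boltzmannDuhamelTerm_le_weighted G hbm hδ (s + n - 1) n s hk le_rfl hB F₀ hF' ht Z
  refine h.trans ?_
  have hc := chainConst_pow_le hA hlam ht s n (Fintype.card d) hn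
  have hexp : 0 ≤ exp (-(lam / 2) * Literature.Analysis.FluidPDE.configEnergy Z) := (exp_pos _).le
  calc B * (A * (sqrt (lam / 2) ^ Fintype.card d)⁻¹ *
          ((s + n - 1 : ℕ) * (sqrt (lam / 2))⁻¹ + sqrt ((s + n - 1 : ℕ) / (lam / (2 * n))))) ^ n *
          t ^ n / n ! * exp (-(lam / 2) * Literature.Analysis.FluidPDE.configEnergy Z)
        = B * ((A * (sqrt (lam / 2) ^ Fintype.card d)⁻¹ *
          ((s + n - 1 : ℕ) * (sqrt (lam / 2))⁻¹ + sqrt ((s + n - 1 : ℕ) / (lam / (2 * n))))) ^ n *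
          t ^ n / n !) * exp (-(lam / 2) * Literature.Analysis.FluidPDE.configEnergy Z) := by ring
    _ ≤ B * (exp (s - 1) * (exp 2 * sqrt 2 ^ (Fintype.card d + 3) * A * t /
          sqrt lam ^ (Fintype.card d + 1)) ^ n) * exp (-(lam / 2) * Literature.Analysis.FluidPDE.configEnergy Z) := by
        gcongr
    _ ≤ B * (exp (s - 1) * ((exp 2 * sqrt 2 ^ (Fintype.card d + 3) * A + 1) * t /
          sqrt lam ^ (Fintype.card d + 1)) ^ n) * exp (-(lam / 2) * Literature.Analysis.FluidPDE.configEnergy Z) := by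
        have hsl : 0 < sqrt lam ^ (Fintype.card d + 1) := pow_pos (sqrt_pos.2 hlam) _
        have hC : exp 2 * sqrt 2 ^ (Fintype.card d + 3) * A ≤
            exp 2 * sqrt 2 ^ (Fintype.card d + 3) * A + 1 := by linarith
        have h0 : 0 ≤ exp 2 * sqrt 2 ^ (Fintype.card d + 3) * A * t /
            sqrt lam ^ (Fintype.card d + 1) := by positivity
        have hle' : exp 2 * sqrt 2 ^ (Fintype.card d + 3) * A * t / sqrt lam ^ (Fintype.card d + 1) ≤
            (exp 2 * sqrt 2 ^ (Fintype.card d + 3) * A + 1) * t / sqrt lam ^ (Fintype.card d + 1) :=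
          div_le_div_of_nonneg_right (mul_le_mul_of_nonneg_right hC ht) hsl.le
        have hpow := pow_le_pow_left₀ h0 hle' n
        have hs0 : 0 ≤ exp ((s : ℝ) - 1) := (exp_pos _).le
        exact mul_le_mul_of_nonneg_right
          (mul_le_mul_of_nonneg_left (mul_le_mul_of_nonneg_left hpow hs0) hB) hexp
    _ = _ := by ring

/-- **BGSR Lemma 4.2, (4.9) (BBGKY hierarchy)**, in the tree's normalisation of the collision
operator (`C_{s,s+1}` with prefactor `(N-s)ε^{d-1}`, GST 2013 (4.3.5); BGSR (3.4) divide by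
`α = Nε^{d-1}`, which turns the factor `(C N ε^{d-1} t)ⁿ` below into the printed `(C t)ⁿ`).
There is a constant `C` depending only on `d` such that, for every position space, geometry,
diameter `ε ≥ 0`, particle number `N`, hard-sphere flows `Φ^s` conserving the kinetic energy
(hypothesis `hΦE` of `Kinetic.IsMildBBGKYSolutionOn.eq_sum_bbgkyDuhamelTerm`), every `λ > 0`,
`s ∈ ℕ`, `n ≥ 1`, `t ≥ 0` and every family `F₀` with `|F₀^{(s+n)}| ≤ B e^{-λ H_{s+n}}`
(`B ≥ 0`): `|Q_{s,s+n}(t) F₀ (Z_s)| ≤ e^{s-1} (C N ε^{d-1} t / λ^{(d+1)/2})ⁿ B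
e^{-(λ/2) H_s(Z_s)}`. As for (4.10) the proof bounds the majorant `|Q|_{s,s+n}(t)|F₀|`; the
bound is pointwise (the printed spaces `X_{ε,k,λ}` use essential suprema on `D_ε^k` for the
a.e.-defined flow; here the flows are the everywhere-defined modifications `HardSphereFlow`).
[cite: BodineauGallagherSaintRaymondInvent2016, §4.2 Lemma 4.2 (4.9), p. 11] -/
theorem bgsr_lemma42_bbgky (d : Type*) [Fintype d] :
    ∃ C : ℝ, 0 < C ∧ ∀ {X : Type u} [MeasureSpace X] [TopologicalSpace X] (G : Literature.Analysis.FluidPDE.Geometry d X)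
      {ε : ℝ}, 0 ≤ ε → ∀ (N : ℕ) (Φ : (s : ℕ) → Literature.Analysis.FluidPDE.HardSphereFlow G ε s),
      (∀ (s : ℕ) (t : ℝ) (z : Literature.Analysis.FluidPDE.Config s d X), Literature.Analysis.FluidPDE.configEnergy ((Φ s).flow t z) = Literature.Analysis.FluidPDE.configEnergy z) →
      ∀ {lam : ℝ}, 0 < lam → ∀ (s n : ℕ), 1 ≤ n → ∀ {t : ℝ}, 0 ≤ t → ∀ (F₀ : Literature.Analysis.FluidPDE.GCState d X)
      {B : ℝ}, 0 ≤ B →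
      (∀ Z : Literature.Analysis.FluidPDE.Config (s + n) d X, |F₀ (s + n) Z| ≤ B * exp (-lam * Literature.Analysis.FluidPDE.configEnergy Z)) →
      ∀ Z : Literature.Analysis.FluidPDE.Config s d X,
        |Literature.Analysis.FluidPDE.bbgkyDuhamelTerm G ε N Φ n s t F₀ Z| ≤
          exp (s - 1) * (C * (N * ε ^ (Fintype.card d - 1)) * t / sqrt lam ^ (Fintype.card d + 1)) ^ n *
            B * exp (-(lam / 2) * Literature.Analysis.FluidPDE.configEnergy Z) := by
  haveI := Literature.Analysis.FluidPDE.isFiniteMeasure_sphereMeasure (E := EuclideanSpace ℝ d)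
  set A : ℝ := (∫ u : EuclideanSpace ℝ d, (1 + ‖u‖) * exp (-(1 / 2) * ‖u‖ ^ 2)) *
    (KineticTheory.sphereMeasure : Measure (sphere (0 : EuclideanSpace ℝ d) 1)).real univ with hAdef
  have hJ : 0 ≤ ∫ u : EuclideanSpace ℝ d, (1 + ‖u‖) * exp (-(1 / 2) * ‖u‖ ^ 2) :=
    integral_nonneg fun u => by positivity
  have hA : 0 ≤ A := mul_nonneg hJ measureReal_nonneg
  refine ⟨exp 2 * sqrt 2 ^ (Fintype.card d + 3) * A + 1, by positivity, ?_⟩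
  intro X _ _ G ε hε N Φ hΦE lam hlam s n hn t ht F₀ B hB hF Z
  have hn0 : (0 : ℝ) < n := by exact_mod_cast hn
  have hbm : 0 < lam / 2 := by positivity
  have hδ : 0 < lam / (2 * n) := by positivity
  have hk : s + n ≤ (s + n - 1) + 1 := by omega
  have hF' : ∀ Z : Literature.Analysis.FluidPDE.Config (s + n) d X,
      |F₀ (s + n) Z| ≤ B * exp (-(lam / 2 + n * (lam / (2 * n))) * Literature.Analysis.FluidPDE.configEnergy Z) := by
    intro Z
    convert hF Z using 3
    field_simp
    ring
  set κ : ℝ := N * ε ^ (Fintype.card d - 1) with hκ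
  have hκ0 : 0 ≤ κ := by positivity
  have h := abs_bbgkyDuhamelTerm_le_weighted G hε N Φ hΦE hbm hδ (s + n - 1) n s hk le_rfl hB F₀
    hF' ht Z
  refine h.trans ?_
  have hc := chainConst_pow_le (mul_nonneg hκ0 hA) hlam ht s n (Fintype.card d) hn
  have hexp : 0 ≤ exp (-(lam / 2) * Literature.Analysis.FluidPDE.configEnergy Z) := (exp_pos _).le
  calc B * ((κ * A) * (sqrt (lam / 2) ^ Fintype.card d)⁻¹ *
          ((s + n - 1 : ℕ) * (sqrt (lam / 2))⁻¹ + sqrt ((s + n - 1 : ℕ) / (lam / (2 * n))))) ^ n *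
          t ^ n / n ! * exp (-(lam / 2) * Literature.Analysis.FluidPDE.configEnergy Z)
        = B * (((κ * A) * (sqrt (lam / 2) ^ Fintype.card d)⁻¹ *
          ((s + n - 1 : ℕ) * (sqrt (lam / 2))⁻¹ + sqrt ((s + n - 1 : ℕ) / (lam / (2 * n))))) ^ n *
          t ^ n / n !) * exp (-(lam / 2) * Literature.Analysis.FluidPDE.configEnergy Z) := by ring
    _ ≤ B * (exp (s - 1) * (exp 2 * sqrt 2 ^ (Fintype.card d + 3) * (κ * A) * t /
          sqrt lam ^ (Fintype.card d + 1)) ^ n) * exp (-(lam / 2) * Literature.Analysis.FluidPDE.configEnergy Z) := by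
        gcongr
    _ ≤ B * (exp (s - 1) * ((exp 2 * sqrt 2 ^ (Fintype.card d + 3) * A + 1) * κ * t /
          sqrt lam ^ (Fintype.card d + 1)) ^ n) * exp (-(lam / 2) * Literature.Analysis.FluidPDE.configEnergy Z) := by
        have hsl : 0 < sqrt lam ^ (Fintype.card d + 1) := pow_pos (sqrt_pos.2 hlam) _
        have hC : exp 2 * sqrt 2 ^ (Fintype.card d + 3) * (κ * A) ≤
            (exp 2 * sqrt 2 ^ (Fintype.card d + 3) * A + 1) * κ := by
          nlinarith [mul_nonneg hκ0 hA, (exp_pos (2 : ℝ)).le, pow_nonneg (sqrt_nonneg (2 : ℝ)) (Fintype.card d + 3)]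
        have h0 : 0 ≤ exp 2 * sqrt 2 ^ (Fintype.card d + 3) * (κ * A) * t /
            sqrt lam ^ (Fintype.card d + 1) := by positivity
        have hle' : exp 2 * sqrt 2 ^ (Fintype.card d + 3) * (κ * A) * t / sqrt lam ^ (Fintype.card d + 1) ≤
            (exp 2 * sqrt 2 ^ (Fintype.card d + 3) * A + 1) * κ * t / sqrt lam ^ (Fintype.card d + 1) :=
          div_le_div_of_nonneg_right (mul_le_mul_of_nonneg_right hC ht) hsl.le
        have hpow := pow_le_pow_left₀ h0 hle' n
        have hs0 : 0 ≤ exp ((s : ℝ) - 1) := (exp_pos _).le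
        exact mul_le_mul_of_nonneg_right
          (mul_le_mul_of_nonneg_left (mul_le_mul_of_nonneg_left hpow hs0) hB) hexp
    _ = _ := by ring

end Lemma42

end Kinetic

end

end Literature.MathematicalPhysics.KineticTheory
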